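import Mathlib
import HarnessLib
import HarnessLib.Audit
import Summits.Parity.Statement
import Literature.NumberTheory.LFunctions.NoRealZeroUpTo
import Literature.NumberTheory.LFunctions.RealCharacterLadderLeaves
import Literature.NumberTheory.LFunctions.NoRealZeroSmallModuli
import HarnessLib.Audit.Status.Attr

/-!
Route: RealCharacterOddThirtyBillion

DORMANT since 2026-09-01T18:02:20Z (reconciler: no traction for 5 d (last activity statement-checked at 2026-08-27T17:02:50Z); parked, not closed — `ledger route dormant route-Parity-RealCharacterOddThirtyBillion --off` to reactivate) — unstaffed, not closed; items shared with open routes are served there. `ledger route dormant <id> --off` reactivates.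

# Route RealCharacterOddThirtyBillion — no real zero for every ODD quadratic primitive χ mod q ≤
3·10¹⁰ (100× Watkins), the rung above the certified decade, by two tile blocks over the odd 10¹⁰
leaf

X = "for every modulus 3 ≤ q ≤ 3·10¹⁰, every primitive quadratic ODD Dirichlet character χ mod q (χ
= χ_d, d < 0, |d| = q) and every real
σ ∈ (0,1), L(σ,χ) ≠ 0" = the rung leaf `Literature.NumberTheory.LFunctions.NoRealZeroOddUpTo_3e10`
(body `NoRealZeroOddUpTo 30000000000`;
to be landed by the cell's prover and listed as D-0061 alt-closer F-P2e 'closes rung (10¹⁰,3·10¹⁰]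
odd of Parity' — SWEEP-BOARD R-15). It
suffices to show X = D ∧ T_lo ∧ T_hi: D = the odd decade leaf `NoRealZeroOddUpTo 10000000000` (route
RealCharacterDecadeTen's closes-target,
imported here as ONE residual support item, not re-itemised), T_lo = no real zero for odd χ_d with
10¹⁰ < |d| ≤ 2.125·10¹⁰ (board §4 tiles
t1–t6) and T_hi = the same for 2.125·10¹⁰ < |d| ≤ 3·10¹⁰ (tiles t7–t12), cut at the tile boundary
t6|t7 so that each block books exactly
when its six tiles book (R-1: lineages C ∧ BW, referee-signed, per tile). D-0059 route OF RECORD for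
the rung «100× Watkins» of cell
parity-realchar (SIEGEL INSTRUMENT, D-0070); the blocks are decided by certified numerics, not
kernel proof, and carry that currency label.
Lean: `Literature.NumberTheory.LFunctions.NoRealZeroOddUpTo 30000000000`

## Assembly
Pure logic: range split q ≤ 10¹⁰ ∨ 10¹⁰ < q ≤ 2.125·10¹⁰ ∨ 2.125·10¹⁰ < q ≤ 3·10¹⁰ (`omega`); the
deciding theorem `closes` (glue-F.lean; farm rc 0,
0 sorries in the seat's SketchF.lean `assembly_proof`) concludes `NoRealZeroOddUpTo 30000000000` (=
the leaf `NoRealZeroOddUpTo_3e10` once landed).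

CLOSES_TARGET: closes rung F-P2e of Parity: Literature.NumberTheory.LFunctions.NoRealZeroOddUpTo_3e10 (D-0061; not the summit Statement) — the deciding theorem of this route concludes that registered leaf instead of the Statement decl `GeneralizedHardyLittlewood` (class rung: servable and labelled, never counted as concluding the summit Statement).

Rationale: WHY THIS LINE. Mechanism (unchanged from the decade): a real zero σ ∈ (0,1) of L(s,χ_d) is a zero of
the completed theta integral Λ_d(σ) = ξ(σ,χ_d), whose
positivity on [0,1] is decidable row by row by certified evaluation — lineage C (integer-only
two-end batch interpolation + exact per-row
retry; measured 1.16 thread-ms/row at 3·10¹⁰, rehearsal j248453) and lineage BW regime 3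
(integer-only Bernstein/Chebyshev panel enclosures +
in-job regime-1 second pass; rehearsal j248158), code-disjoint, value-joined by the referee; tree
criterion `noRealZeroUpTo_iff_dirichletXi_re_pos`
(p403290). Print for odd characters stops at |d| ≤ 3·10⁸ (Watkins2004RealZeros, one implementation);
Lu–Zaman–Zhao 2026 (arXiv:2602.03626
Thm 1.1) reach q ≤ 10¹⁰ only in the NARROW window σ ≥ 1 − 1/(5 log q); nothing in print decides the
wide interval above 10¹⁰. What this route
does that the decade route does not: it types the director's rung (10¹⁰,3·10¹⁰] (01:20:01Z START
RULE) — 100× Watkins — as two booking blocks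
aligned with the equal-cost tiling (RUNG3e10-TILES.json: 12 tiles of equal ∫√q, boundaries multiples
of 10⁷), imports the decade as a single
residual, and its cheapest falsifier (the two-lineage rehearsal cell at the TOP of the rung) has
already been run and passed engine-side.
Nothing is imported from another area; no new mathematics is claimed; consumers take the leaf as a
hypothesis (`NoRealZeroOddUpTo.anti_level`).

RANKED CRUXES. #2 OddRungHigh (crux) — for every modulus 2.125·10¹⁰ < q ≤ 3·10¹⁰, every primitive
quadratic ODD χ mod q and every σ ∈ (0,1), L(σ,χ) ≠ 0 (2 659 680 937 fundamental d < 0 = N₋(3·10¹⁰)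
− N₋(2.125·10¹⁰) = 9 118 906 425 − 6 459 225 488, three independent Möbius counts incl. referee V66;
board §4 tiles t7–t12; DATA lineages C ∧ BW per tile (R-10…R-13), R-12(a) at-height signatures
GRANTED for both lineages (referee V68, 03:44Z), tiles claimable per R-13; currency: certified
numerics, two code-disjoint lineages, referee-booked per tile). [difficulty: L] (why it might fail:
false iff an odd d with 2.125·10¹⁰ < |d| ≤ 3·10¹⁰ has a real zero; evidence-side both lineages'
per-row error grows with √q (at 3·10¹⁰: C 30 batch retries / 3·10⁵ rows, BW 16 pass-2 rows) — one
row uncertified on both exact paths, or one C-vs-BW disjoint enclosure, voids its tile.)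
[Watkins2004RealZeros, arXiv:2602.03626, Platt2016GRH]
#3 OddRungLow (crux) — for every modulus 10¹⁰ < q ≤ 2.125·10¹⁰, every primitive quadratic ODD χ mod
q and every σ ∈ (0,1), L(σ,χ) ≠ 0 (3 419 590 045 fundamental d < 0 = 6 459 225 488 − 3 039 635 443;
board §4 tiles t1–t6; DATA lineages C ∧ BW per tile, BW jobs cut at tile pairs (R-11); currency:
certified numerics). [difficulty: L] (why it might fail: false iff an odd d with 10¹⁰ < |d| ≤
2.125·10¹⁰ has a real zero; budget-side the block is ≈ 3.4·10⁹ rows × 2 lineages and books only if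
the rung fits the 5 500 core-h envelope (R-9′): projection ≈ 4 955 with the wheel-v3 BW kernel
(V69); a decade overrun > 500 breaks it.) [Watkins2004RealZeros, arXiv:2602.03626, Platt2016GRH]
#9 OddToTenBillion (support) — no real zero in (0,1) for every primitive quadratic ODD χ mod 3 ≤ q ≤
10¹⁰ — exactly the closes-target of route RealCharacterDecadeTen (leaf `NoRealZeroOddUpTo_1e10`,
F-P2c; items PlattRange / OddToHundredMillion / OddToBillion / OddLowDecade / OddHighDecade there);
imported here as ONE residual block, closed by one line from that route's `closes` when it fires;
not re-decomposed in this route. [difficulty: XL] [Watkins2004RealZeros, Platt2016GRH,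
arXiv:2602.03626]

TWO-LAYER PLAN. Foreseen glued split of each block into its tiles only if a tile stalls (OddRungLow
⇐ t1 → … → t6, boundaries 1.221/1.424/1.613/1.792/1.962
·10¹⁰; OddRungHigh ⇐ t7 → … → t12, boundaries 2.282/2.434/2.581/2.724/2.864 ·10¹⁰) — nothing filed
now; tiles are engine bookkeeping on
HOME/SWEEP-BOARD.md §4. No even rung is planned (even print is 4·10⁵; the even decade already gives
25 000×). A further rung (3·10¹⁰,10¹¹]
would be one more block over this leaf and is outside the current envelope.

KILL CRITERIA. A certified real zero (an interval on which Λ_d < 0 for some odd d with |d| ≤ 3·10¹⁰,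
reproduced by the second lineage) refutes the block
containing d, closes the route `refuted:<Block>`, and is a counterexample to Chowla's conjecture. A
referee GAP verdict on a tile (disjoint
value-level enclosures between C and BW, or an UNCERTIFIED row surviving both exact per-row paths
and the A′ deep recheck) not repaired inside
the envelope, or the envelope itself (R-9′: rung unaffordable after a decade overrun and no top-up),
sends this route dormant; the decade
routes stand regardless.

NOT DECOMPOSED YET. No per-tile, per-batch or per-discriminant items (12 tiles, ≈ 4·10⁵ batches):
bookkeeping lives on HOME/SWEEP-BOARD.md §4 and DATA.md. The
decade is deliberately ONE support item (its five blocks are route RealCharacterDecadeTen's items;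
re-itemising them here would only
duplicate wanted_by edges). No items for the ξ-positivity form, the central-value enclosures /
near-miss rows at height (HOME/NEAR-MISS data),
or consumers. No kernel replay of any row above |d| = 23 is planned.

CHEAPEST FALSIFIER. The STEP-0-at-height join (R-12(a)), ALREADY RUN: the top window [29 999 000
000, 30 000 000 001) odd, n = 303 942 (pre-registered), certified
by lineage C (j248453, ALL_CERTIFIED, min margin/b₀ 0.570) and lineage BW (j248158, kernel of record
3f80a295, ALL_CERTIFIED, 16 pass-2 rows),
engine-side exact rational pre-join: d-sets identical, Λ_d(1/2) enclosures intersect for all 303 942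
rows, 0 disjoint (eng-2 02:44:52Z);
smallest L(1/2) of the window 4.49·10⁻⁴ (d = −29 999 344 219) agreed by both. One disjoint pair
there would have killed the evidence plan for
OddRungHigh before any tile was bought; the referee's at-height signatures were GRANTED for both
lineages (V68, referee-own exact join: d-sets identical, 0 disjoint, worst normalised distance
0.0005), so t1 may be claimed (R-13).

NUMBERS. Printed wide frontier (odd): |d| ≤ 3·10⁸ (Watkins2004RealZeros) ⇒ this leaf is 100×;
narrow: q ≤ 10¹⁰ (arXiv:2602.03626 Thm 1.1). Counts:
N₋(10¹⁰) = 3 039 635 443, N₋(2.125·10¹⁰) = 6 459 225 488, N₋(3·10¹⁰) = 9 118 906 425 (sweep-3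
RUNG3e10-TILES.json + referee V66) ⇒ OddRungLow
3 419 590 045 rows, OddRungHigh 2 659 680 937 rows, rung total 6 079 270 982. Cost: C ≈ 1 500–1 700
thread-h (1.16 ms/row measured at the
top), BW ≈ 450–530 core-h on the byte-identical wheel-v3 kernel 89947d2c ADOPTED by the referee
(V69; AMX 09028059 deferred, ≈ 150–300 if adopted); envelope 5 500 for decade + rung (board
R-9/R-9′; projection HOME/parity-realchar-theory/ENVELOPE-PROJECTION.md).

DEFINITION REQUESTS. None from Literature. The leaf
`Literature.NumberTheory.LFunctions.NoRealZeroOddUpTo_3e10 : Prop := NoRealZeroOddUpTo 30000000000`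
(+ `.to_1e10`
projection) LANDED in RealCharacterLadderLeaves.lean :122 (p420018 ACCEPTED 04:00Z, with `.to_1e10`
and `.to_watkins`); the route is certified against it as
closes-target (alternative closer F-P2e, SWEEP-BOARD R-15).

Novelty: Searches (2026-08-26, re-run for the rung): lit search --hybrid "real zeros quadratic Dirichlet
L-functions verified computation large discriminant" (textbook hits: Montgomery–Vaughan 2007 p.109,
Cohen 1993); lit search "Landau-Siegel zeros numerical verification" --source all (local
arXiv:2602.03626 pp.1,16,20; arXiv:2301.10722 p.9; remote doi:10.1090/mcom/4268); lit galaxy search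
"Landau-Siegel zero|no Siegel zero|real zeros of real" --star all (no verification table above
10¹⁰); lean search 'NoRealZeroOddUpTo' (tree leaves to 1e10 only).
Nearest prior art found: Watkins2004RealZeros (odd, |d| ≤ 3·10⁸) [corpus: tree
NoRealZeroPrintedFrontier.lean cite]; arXiv:2602.03626 Thm 1.1 [corpus:arxiv-2602.03626 p.1] (q ≤
10¹⁰, NARROW); the cell's own decade routes RealCharacterDecadeTen / RealCharacterDecadeTenEven
(10¹⁰ wide, in progress).
Delta: the odd wide column moves from 10¹⁰ (this cell) to 3·10¹⁰ = 100× the printed odd frontier,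
two code-disjoint certified lineages per tile, typed as two blocks over the decade leaf; no new
mathematics is claimed.
Claimed grade: variant  [refs: 10.1090/mcom/4268, 2602.03626, 2301.10722, doi:10.1090/mcom/4268, arxiv-2602.03626]

Barriers (technique_class: certified-numerics, theta-positivity, interval-arithmetic): - technique_class: certified-numerics, theta-positivity, interval-arithmetic
- Literature.Barriers.Parity.SiegelZeroTwinPrimes: it does not touch it and does not try — a finite
table (q ≤ 3·10¹⁰) implies nothing about Siegel zeros of unbounded quality or about twin primes
(H4/H5 of the cell); the route is an instrument (explicit exclusion for q ≤ Q), not a summit move.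
- Literature.Barriers.Parity.SiegelZeroPrimePairBarrier: outside its class — no shift-uniform
prime-pair bound is claimed or used; the only output is L(σ,χ_d) ≠ 0 on (0,1) for odd |d| ≤ 3·10¹⁰.
- Literature.Barriers.Parity.BrunTitchmarshSiegelZero: not in its class (no sieve bound is improved;
nothing asymptotic is claimed). (Method-governing, uncatalogued for Parity:
`Literature/Barriers/RiemannHypothesis/EpsteinZetaRealZerosSmallK.lean` blocks the kernel class-sum
method from d ≥ 200 — hence certified numerics above |d| = 144.)
- Negatives index: empty for these statements at staging (no refuted `NoRealZero*` /
`NoExceptionalZero*` instance in `ledger negatives --problem Parity`; 4 unrelated Parity negatives).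

History (route lifecycle, newest last):
- 2026-09-01T18:02:20Z · DORMANT — reconciler: no traction for 5 d (last activity statement-checked at 2026-08-27T17:02:50Z); parked, not closed — `ledger route dormant route-Parity-RealCharacter (operator:999:3009727)

sub-problem: GeneralizedHardyLittlewood · status: dormant · opened planner-parity-realchar-theory-g5-0 2026-08-26T04:12:46Z · rev 0 · ledger route-Parity-RealCharacterOddThirtyBillion
GENERATED by the gate from the ledger (D-0016/17). Provers cite these decls: `theorem foo : Summit.Parity.GeneralizedHardyLittlewood.Theses.RealCharacterOddThirtyBillion.<Decl> := …` in Summits/Parity/GeneralizedHardyLittlewood/Theorems/<Name>.lean.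
-/

namespace Summit.Parity.GeneralizedHardyLittlewood.Theses.RealCharacterOddThirtyBillion

open scoped BigOperators Topology Manifold Classical MeasureTheory ProbabilityTheory Matrix InnerProductSpace ComplexConjugate ContinuousMap
open Filter Set Function TopologicalSpace MeasureTheory

attribute [summit_statement] _root_.GeneralizedHardyLittlewood
attribute [summit_statement] _root_.Literature.NumberTheory.LFunctions.NoRealZeroOddUpTo_3e10

/-- item stmt-Parity-19289 · crux · rank 2 · open · by planner
why it might fail: false iff an odd d with 2.125·10¹⁰ < |d| ≤ 3·10¹⁰ has a real zero; evidence-side both lineages' per-row error grows with √q (at 3·10¹⁰: C 30 batch retries / 3·10⁵ rows, BW 16 pass-2 rows) — one row uncertified on both exact paths, or one C-vs-BW disjoint enclosure, voids its tile.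
sources: Watkins2004RealZeros, arXiv:2602.03626, Platt2016GRH
[crux] for every modulus 2.125·10¹⁰ < q ≤ 3·10¹⁰, every primitive quadratic ODD χ mod q and every σ
∈ (0,1), L(σ,χ) ≠ 0 (2 659 680 937 fundamental d < 0 = N₋(3·10¹⁰) − N₋(2.125·10¹⁰) = 9 118 906 425 −
6 459 225 488, three independent Möbius counts incl. referee V66; board §4 tiles t7–t12; DATA
lineages C ∧ BW per tile (R-10…R-13), R-12(a) at-height signatures GRANTED for both lineages
(referee V68, 03:44Z), tiles claimable per R-13; currency: certified numerics, two code-disjoint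
lineages, referee-booked per tile). [difficulty: L] -/
@[route_item "route-Parity-RealCharacterOddThirtyBillion", crux]
def OddRungHigh : Prop :=
  ∀ (q : ℕ) [NeZero q], 21250000000 < q → q ≤ 30000000000 → ∀ χ : DirichletCharacter ℂ q, χ.IsQuadratic → χ.IsPrimitive → χ.Odd → ∀ σ : ℝ, 0 < σ → σ < 1 → χ.LFunction σ ≠ 0

/-- item stmt-Parity-19290 · crux · rank 3 · open · by planner
why it might fail: false iff an odd d with 10¹⁰ < |d| ≤ 2.125·10¹⁰ has a real zero; budget-side the block is ≈ 3.4·10⁹ rows × 2 lineages and books only if the rung fits the 5 500 core-h envelope (R-9′): projection ≈ 4 955 with the wheel-v3 BW kernel (V69); a decade overrun > 500 breaks it.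
sources: Watkins2004RealZeros, arXiv:2602.03626, Platt2016GRH
[crux] for every modulus 10¹⁰ < q ≤ 2.125·10¹⁰, every primitive quadratic ODD χ mod q and every σ ∈
(0,1), L(σ,χ) ≠ 0 (3 419 590 045 fundamental d < 0 = 6 459 225 488 − 3 039 635 443; board §4 tiles
t1–t6; DATA lineages C ∧ BW per tile, BW jobs cut at tile pairs (R-11); currency: certified
numerics). [difficulty: L] -/
@[route_item "route-Parity-RealCharacterOddThirtyBillion", crux]
def OddRungLow : Prop :=
  ∀ (q : ℕ) [NeZero q], 10000000000 < q → q ≤ 21250000000 → ∀ χ : DirichletCharacter ℂ q, χ.IsQuadratic → χ.IsPrimitive → χ.Odd → ∀ σ : ℝ, 0 < σ → σ < 1 → χ.LFunction σ ≠ 0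

/-- item stmt-Parity-19291 · support · rank 9 · open · by planner
sources: Watkins2004RealZeros, Platt2016GRH, arXiv:2602.03626
[support] no real zero in (0,1) for every primitive quadratic ODD χ mod 3 ≤ q ≤ 10¹⁰ — exactly the
closes-target of route RealCharacterDecadeTen (leaf `NoRealZeroOddUpTo_1e10`, F-P2c; items
PlattRange / OddToHundredMillion / OddToBillion / OddLowDecade / OddHighDecade there); imported here
as ONE residual block, closed by one line from that route's `closes` when it fires; not
re-decomposed in this route. [difficulty: XL] -/
@[route_item "route-Parity-RealCharacterOddThirtyBillion", crux]
def OddToTenBillion : Prop :=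
  Literature.NumberTheory.LFunctions.NoRealZeroOddUpTo 10000000000

/-- item stmt-Parity-19292 · assembly · rank 1 · open · by planner
sources: Watkins2004RealZeros
[assembly] OddToTenBillion → OddRungLow → OddRungHigh → no real zero for odd quadratic χ up to
3·10¹⁰. -/
@[route_item "route-Parity-RealCharacterOddThirtyBillion"]
def Assembly : Prop :=
  OddToTenBillion → OddRungLow → OddRungHigh → Literature.NumberTheory.LFunctions.NoRealZeroOddUpTo 30000000000

/-! D-0027 §2.1 — DECIDING THEOREM (planner-authored via `route open/edit --closes-file`; by planner-parity-realchar-theory-g5-0 2026-08-26T04:12:46Z):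
its hypotheses are this route's items and its conclusion the registered leaf `Literature.NumberTheory.LFunctions.NoRealZeroOddUpTo_3e10` (rung F-P2e, D-0061) (glue_lint), and it elaborates with this file. -/

@[closes "route-Parity-RealCharacterOddThirtyBillion"] theorem closes (h10 : OddToTenBillion) (hlo : OddRungLow) (hhi : OddRungHigh) :
    Literature.NumberTheory.LFunctions.NoRealZeroOddUpTo_3e10 := by
  show Literature.NumberTheory.LFunctions.NoRealZeroOddUpTo 30000000000
  intro q _ hq3 hqQ χ hquad hprim hodd σ hσ0 hσ1
  by_cases hqa : q ≤ 10000000000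
  · exact h10 q hq3 hqa χ hquad hprim hodd σ hσ0 hσ1
  by_cases hqb : q ≤ 21250000000
  · exact hlo q (by omega) hqb χ hquad hprim hodd σ hσ0 hσ1
  · exact hhi q (by omega) hqQ χ hquad hprim hodd σ hσ0 hσ1

end Summit.Parity.GeneralizedHardyLittlewood.Theses.RealCharacterOddThirtyBillion
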